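import Summits.BirchSwinnertonDyer.Rank1Residual.Additive.LocIrrValuationCriterionThree
import Summits.BirchSwinnertonDyer.Rank1Residual.O6.TowerInterfaces
import Summits.BirchSwinnertonDyer.Rank1Residual.O5.O5GrowthLaws
import Literature.NumberTheory.EllipticCurves.RootNumberTableThree
import Literature.NumberTheory.EllipticCurves.RootNumber
import HarnessLib

/-!
# O6-dicyclic Mazur–Tate growth laws at the wild prime `3`: the REDUCIBLE LEVEL LAW (D-R, hold-out
# PASSED) and the irreducible SIGNED POLLACK SHAPE (S1–S4, PRE-REGISTRATION 5a) — the two wild clauses of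
# T-O6-D ≡ `MazurTateGrowthDichotomyThree` (`Additive/MazurTateGrowthDichotomyThree.lean`), with their
# arithmetic (level table + isogeny MAX rule = the tower interfaces made CONCRETE, signed base, `ν(k,λ)`,
# the sign `lamM`) (cell `b2b-bsdres`, lane CLASS-CLOSURE, seat cc-typer-5 GEN 3 = O5/O6 typer of record;
# asks A-O6-T2 / A-O6-T3 (a)(b) of o6-r1 GEN 3; content = o6-r1 GEN 3, `cells/o5o6/TARGETS.md` §O6
# (G3-8)–(G3-11); placement, dedup and Lean phrasing = class typer) — TYPED, EVIDENCE-LABELLED, NOTHING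
# ASSERTED

HONEST FRAMING (cell `b2b-bsdres`, verbatim in every file): the goal of the cell is to DELETE the
COMBINATION-SHAPED residual classes of the Birch–Swinnerton-Dyer formula for ALL analytic-rank `≤ 1`
elliptic curves over `ℚ` — "full BSD formula for every rank `≤ 1` curve in class `C`" assembled
STRICTLY from published theorems — so that the rank-`≤ 1` remainder becomes exactly the
CONSTRUCTION-SHAPED classes, which are TYPED (missing-input `Prop`s), NOT attempted. This is not
"finishing BSD". Lane CLASS-CLOSURE: census output is EVIDENCE / conjecture items with held-out
validation, never a Literature fact; no main conjecture inside any certificate; nothing is booked; no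
mark of `RESIDUAL-MAP.md` moves. 0 named Literature facts here; every law below is an `@[conjecture]`
EVIDENCE item (E1 with pre-registration and hold-out, o6-r1 GEN 3), typed over the INTERFACES of
`O6/TowerInterfaces.lean` (`TowerValuation` = D-O6-ν, `IsogenyLevelDatum` = D-O6-prof; their
construction shapes are separate and nothing about the data's existence is smuggled in) and the tree's
Mazur–Tate element (`mazurTateElement f 3 k`, Pollack 2003 Def. 6.15; `O5.IsScaledMazurTateLift`, `lam`
of `X1/MuLambdaAlgebra.lean`). No refuted statement is typed: v1/v2 of the cyclic law and D-I* "λ′ ≡ 0"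
(KILLED on its hold-out, (G3-9)) are absent; the cyclic v3′ shell waits for band C1′ (A-O6-T3 (d)).

Setting: `W/ℚ` additive at `3`, WILD with dicyclic inertia `C₃ ⋊ C₄` (`f₃ ∈ {3, 5}`, `v₃(Δ_min)` odd —
`SubWDicyclic`); `θ_k = ω_{k−1}·u_k` (`Additive.OmegaDvdMazurTateOfAddv`, Doyon–Lei Lemma 5.2 / Cor.
5.3: `λ(θ_k) = 3^{k−1} + λ(u_k)`); `ν_k = ½ + μ(u_k) + λ(u_k)/φ(3^k)` = the `3`-adic valuation of
`τ(ψ)L(W,ψ̄,1)/Ω⁺_W` at even primitive `ψ` of conductor `3^{k+1}` (`TowerValuation.nu`). The selector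
is `LocIrr W 3` (`W[3]|G_{ℚ₃}` irreducible; census-decidable by `Additive.LocIrrCriterionThree`,
theorem-candidate L-O56-sel): at `f₃ = 3` it holds exactly on the rows II `(v₃c₄, v₃c₆, v₃Δ) = (2,4,3)`
and IV* `(4,7,9)`; never at `f₃ ∈ {4, 5}`.

* §1 arithmetic (pure, values PROVED): `dicyclicLevel f v` {(3,3): ½, (3,5): ½, (3,9): 1, (3,11): 1,
  (5,5): 7/6, (5,7): 5/6} (untabled `(5,11)`, `(5,13)` ↦ `none`), the MAX rule `dicyclicEffectiveLevel`
  over the `IsogenyLevelDatum` profile (A-O6-T2), `signedBase v k = ([v = 9]+1)·3^{k−1} + q_{k−1}`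
  (= o5-r1's T9 near-template base over `O5.kuriharaQ`; `= q_{k+1} = ⌊3^{k+1}/4⌋` for IV*,
  `signedBase_nine_eq_kuriharaQ_succ`, PROVED), `nuOfLam k λ = ½ + (λ − 3^{k−1})/φ(3^k)` (the tower
  valuation forced by `λ(θ_k)` when `μ_W(θ_k) = 0` — how "`μ = 0`" is typed INTRINSICALLY, without a
  period-normalisation interface; `= λ/φ(3^k)`, `nuOfLam_eq_div` = LEMMA A's reading at `μ = 0`, PROVED),
  `lamM W = −w(W)·W₃(W)` (cc-eng-3's Atkin–Lehner sign at `M = N/27`).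
* §2 D-R `DicyclicLevelLawThree real realLevel` (UNSIGNED level law on the REDUCIBLE rows; hold-out
  PASSED 151/151) — the `p = 3` wild twin of the SHAPE of Lei–Pollack–Pratap Thm 2 = Thm 4.7 (pot.
  good ordinary `p ≥ 5`, under BSD(k_n): `λ(θ_n) = (p−1)v_p(Δ_E)/12·p^{n−1} + λ(Sel^∨)`).
* §3 S1–S4 on the IRREDUCIBLE rows (`SignedParityLawThree`, `SignedUnitCriterionThree` KILLABLE;
  `SignedStabilisationLawThree`, `SignedMuZeroLawThree` MEASURED) and their conjunction
  `SignedPollackShapeThree real` — verbatim the shape of Pollack 2003 Prop. 6.9–6.10 / Kurihara 2002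
  for GOOD supersingular `a_p = 0`, at a wild additive `3`.

NEAREST PRIOR ART (o6-r1 GEN 3 (G3-12a); honest novelty grade VARIANT / NEW-COMBINATION, not a new
mechanism): Pollack–Weston, Duke 156 (2011), THEOREM 1 (= Cor. 5.3) [galaxy:pdf:-6535538855114364040
p0002–p0003, p0021]: for `p ∤ N`, `f ∈ S_k(Γ₀(N))` `p`-non-ordinary with (i) `ρ̄_f` irreducible of Serre
weight `2`, (ii) `2 < k < p² + 1`, (iii) `ρ̄_f|G_{ℚ_p}` not decomposable, there is `g ∈ S₂(Γ₀(N))`,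
`g ≡ f (mod p)`, `g` ordinary ⟺ `ρ̄_f|G_{ℚ_p}` REDUCIBLE, and (granted `μ = 0`) for `n ≫ 0`:
`λ(θ_n(f)) = pⁿ − pⁿ⁻¹ + λ(g)` if `ρ̄_f|G_{ℚ_p}` is reducible, `= pⁿ − pⁿ⁻¹ + q_{n−1} + λ^{−ε_n}(g)`
if irreducible — the SAME SELECTOR (the residual LOCAL representation) with the same two output shapes
(PW's `q_{n−1}` = our `q_n` shift; reducible ↦ UNSIGNED `L·φ(pⁿ) + ε` with `L = 1`, irreducible ↦
SIGNED). What is NOT in print and is asserted below only as EVIDENCE: level divisible by `p²` (`p = 3`,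
additive, outside every hypothesis of PW Thms 1–2; PW p. 3 leave even the nebentypus weight-2 case
unpursued), the slopes `L ≠ 1` tabled by `(f₃, v₃Δ)` with the isogeny MAX rule, and the wild `p = 3`
signed shape. LITERATURE-SET CHECK (o6-r1 (G3-12), kit j125176, every potentially supersingular
isogeny class with `9 ∣ N ≤ 700`, `θ_k` to `k = 6`): UNSIGNED ⟺ `¬LocIrr` on 139/139, SIGNED ⟺
`LocIrr` on 45/45 (184/184; tame `f₃ = 2`: 44 | 39, wild `f₃ = 3`: 67 | 6, `f₃ = 4`: 20 | 0, `f₃ = 5`: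
8 | 0; all 17 CM `j = 0` classes unsigned; Doyon–Lei's 153a1/153c1/153d1 `LocIrr`, 153b1 potentially
multiplicative) — `gen3/tower/bsdkn_small.tsv` 149b758c8f85006a.

EVIDENCE of record (sha256[:16]): `HOME/b2b-bsdres-o6-r1/gen3/tower/d1_fit_score.txt` f1fe1832df72ed97
(D1 fit, kit j124364; deep D2 j124467), `d1h_score.txt` 8313c50ab7d3a34b (D1H hold-out, kit j124547 +
j124549; frozen scorer `score_d1.py` 31e96a275ba63638; PRE-REGISTRATION 5 = `run/shared/lean/ttrl/
requests.jsonl` l.1516, 5a = l.1534), `engd_theta_out.tsv` f40136cebf7f7bdb (cc-eng-3 ENG-D tables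
6a5d4df1f992bfb8, 2 724 O6-FW rows, two engines agree 8/8 where they overlap); team file
`HOME/cells/o5o6/TARGETS.md` §O6 (G3-8)–(G3-11), CONVERGED ⟦o6-r1 g3 07:25Z⟧. References:
[MazurTate1987] Duke 54 §1; [Pollack2003] Duke 118 Def. 6.15, Prop. 6.9–6.10; [Kurihara2002] Invent. 149
Thm 0.1; [DoyonLei2021] arXiv:2103.06154 Lemma 5.2, Cor. 5.3, §6 [corpus: paper-arxiv-2103.06154
p0009–p0010]; [LeiPollackPratap2024] arXiv:2412.16629 Thm 2 = Thm 4.7 (p. 13), §4.3 [corpus: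
paper-arxiv-2412.16629 p0004, p0013–p0015]; [PollackWeston2011MT] Duke 156 Thm 1 = Cor. 5.3
[galaxy:pdf:-6535538855114364040 p0002–p0003, p0021]; [Rizzo2003] Table II; theory note
`HOME/b2b-bsdres-o6-r1/gen3/O6-GEN3.md` §§1–7 (v3).
-/


set_option autoImplicit false

noncomputable section

open scoped Classical MatrixGroups ModularForm NumberField

open CongruenceSubgroup Polynomial WeierstrassCurve NumberField Literature.NumberTheory.EllipticCurves
  Literature.NumberTheory.EllipticCurves.ModularForms
  Literature.NumberTheory.EllipticCurves.Rank1Residual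
  Literature.NumberTheory.EllipticCurves.Rank1Residual.Typed
  Summit.BirchSwinnertonDyer.Rank1Residual.X1.MuLambda

namespace Summit.BirchSwinnertonDyer.Rank1Residual.Additive

/-! ## §1 Arithmetic vocabulary (pure; values proved) -/

/-- **The dicyclic level table `lev(f₃, v₃Δ_min)`** of o6-r1's D1 fit (TARGETS §O6 (G3-8)): at
`f₃ = 3` (complete by Ogg, `f = v₃Δ − (m−1)`): II `(3,3) ↦ ½`, IV `(3,5) ↦ ½`, IV* `(3,9) ↦ 1`, II*
`(3,11) ↦ 1`; at `f₃ = 5`: II `(5,5) ↦ 7/6`, IV `(5,7) ↦ 5/6`; the `f₃ = 5` rows IV* `(5,11)` and II*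
`(5,13)` are UNTABLED (D1 bounds `≤ 7/6`, `≤ 11/6`; no such row in the hold-out band) ↦ `none`, and
everything else ↦ `none` (the cyclic cell `f₃ = 4` has its own `O6.kodairaOffset`). [folklore] -/
def dicyclicLevel (f v : ℕ) : Option ℚ :=
  if f = 3 ∧ (v = 3 ∨ v = 5) then some (1 / 2)
  else if f = 3 ∧ (v = 9 ∨ v = 11) then some 1
  else if f = 5 ∧ v = 5 then some (7 / 6)
  else if f = 5 ∧ v = 7 then some (5 / 6)
  else none

/-- The table's values. [folklore] -/
theorem dicyclicLevel_values :
    dicyclicLevel 3 3 = some (1 / 2) ∧ dicyclicLevel 3 5 = some (1 / 2) ∧ dicyclicLevel 3 9 = some 1 ∧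
      dicyclicLevel 3 11 = some 1 ∧ dicyclicLevel 5 5 = some (7 / 6) ∧
      dicyclicLevel 5 7 = some (5 / 6) ∧ dicyclicLevel 5 11 = none ∧ dicyclicLevel 5 13 = none ∧
      dicyclicLevel 4 6 = none := by
  simp [dicyclicLevel]

/-- **The effective dicyclic level `L_dr(W)`** = max over the rational `3`-power isogeny class of
`lev(f₃, v₃Δ_min(W̃)) + v₃(ω₁(W̃)/ω₁(W))` — the isogeny-class MAX rule of T-O6-ν v2/v3 (cyclic
`O6.effectiveLevel`) on the dicyclic table, as pure arithmetic on `(f₃(W), v₃Δ_min(W), profile)` where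
`profile` lists `(v₃Δ_min(W̃), shift)` for the members `W̃ ≠ W` (`O6.IsogenyLevelDatum.profile`; `f₃`
is an isogeny invariant). `none` as soon as one member is untabled ("confirm-only" rows of the scorer).
A-O6-T2/T3 (a): the interface made concrete. [folklore] -/
def dicyclicEffectiveLevel (f v : ℕ) (profile : List (ℕ × ℤ)) : Option ℚ :=
  profile.foldr
    (fun q acc => acc.bind fun a => (dicyclicLevel f q.1).map fun l => max a (l + (q.2 : ℚ)))
    (dicyclicLevel f v)

/-- A singleton class has `L_dr = lev(f₃, v₃Δ_min)`. [folklore] -/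
theorem dicyclicEffectiveLevel_nil (f v : ℕ) :
    dicyclicEffectiveLevel f v [] = dicyclicLevel f v := rfl

/-- Census class shapes (D1/D1H rows, `members` column of the scorer): 2160p1 (II, a 3-isogenous IV
member of period `Ω/3`): `½`; 2295h1 (IV*, II* member of period `Ω/3`): `1`; 2646bb1 (II with an IV*
member of EQUAL period and a IV member of period `Ω/3`): promoted to `1`; **54a1** (IV* with a
3-isogenous II member of period `3Ω` and a II* member of period `Ω/3`): promoted to `3/2`; a `f₃ = 5`
class with an untabled member: `none`. [folklore] -/
theorem dicyclicEffectiveLevel_examples :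
    dicyclicEffectiveLevel 3 3 [(5, -1)] = some (1 / 2) ∧
    dicyclicEffectiveLevel 3 9 [(11, -1)] = some 1 ∧
    dicyclicEffectiveLevel 3 3 [(9, 0), (5, -1)] = some 1 ∧
    dicyclicEffectiveLevel 3 9 [(3, 1), (11, -1)] = some (3 / 2) ∧
    dicyclicEffectiveLevel 5 5 [(13, -1)] = none := by
  simp only [dicyclicEffectiveLevel, dicyclicLevel, List.foldr]
  norm_num [max_def]

/-- **The signed base `b_k(v)`** of the LocIrr template: `b_k = ([v = 9] + 1)·3^{k−1} + q_{k−1}` with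
o5-r1's `O5.kuriharaQ` (`q_0 = q_1 = 0, q_2 = 2, q_3 = 6, q_4 = 20, …`) — LITERALLY T9's CM-near
template base `b(W)·3^{n−1} + q_{n−1}` with `b = 2` for `v₃Δ = 9` (III*, and the wild IV* row
`(4,7,9)`) and `b = 1` for `v₃Δ = 3` (III, and the wild II row `(2,4,3)`) (o6-r1 (G3-10) TEMPLATE
IDENTITY); equal to o6-r1's closed forms `⌊3^{k+1}/4⌋` (IV*) and `3^{k−1} + ⌊3^{k−1}/4⌋` (II)
(`signedBase_nine_eq_kuriharaQ_succ`, `signedBase_values`). [cite: Kurihara2002, Thm. 0.1] [cite: Pollack2003, Prop. 6.9–6.10] -/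
def signedBase (v k : ℕ) : ℕ := (if v = 9 then 2 else 1) * 3 ^ (k - 1) + O5.kuriharaQ (k - 1)

/-- Values `k = 1..5`: IV* `2, 6, 20, 60, 182` (`= q_k` in o6-r1's indexing `= ⌊3^{k+1}/4⌋`); II
`1, 3, 11, 33, 101`. [folklore] -/
theorem signedBase_values :
    signedBase 9 1 = 2 ∧ signedBase 9 2 = 6 ∧ signedBase 9 3 = 20 ∧ signedBase 9 4 = 60 ∧
      signedBase 9 5 = 182 ∧ signedBase 3 1 = 1 ∧ signedBase 3 2 = 3 ∧ signedBase 3 3 = 11 ∧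
      signedBase 3 4 = 33 ∧ signedBase 3 5 = 101 := by
  decide

/-- **o6-r1's `q_k` is o5-r1's `q_{k+1}`**: `2·3^{k−1} + q_{k−1} = q_{k+1}` (`= ⌊3^{k+1}/4⌋`) for
`k ≥ 1` — the index shift both planners noted, proved. [folklore] -/
theorem signedBase_nine_eq_kuriharaQ_succ (k : ℕ) (hk : 1 ≤ k) :
    signedBase 9 k = O5.kuriharaQ (k + 1) := by
  obtain ⟨m, rfl⟩ : ∃ m, k = m + 1 := ⟨k - 1, by omega⟩
  simp only [signedBase, if_true, Nat.add_sub_cancel, O5.kuriharaQ]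
  have hpar : (m + 1 + 1) % 2 = m % 2 := by omega
  rw [hpar]
  have h3m : 1 ≤ 3 ^ m := Nat.one_le_pow _ _ (by norm_num)
  have hpow : 3 ^ (m + 1 + 1) = 9 * 3 ^ m := by ring
  rw [hpow]
  -- `r ≤ 3^m` and `4 ∣ 3^m − r` for the residue `r ∈ {1, 3}` selected by the parity of `m`
  have key : ∀ r : ℕ, r ≤ 3 ^ m → 4 ∣ 3 ^ m - r →
      2 * 3 ^ m + (3 ^ m - r) / 4 = (9 * 3 ^ m - r) / 4 := by
    intro r hr hdvd
    obtain ⟨t, ht⟩ := hdvd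
    have h1 : 9 * 3 ^ m - r = 4 * (2 * 3 ^ m + t) := by omega
    rw [ht, h1, Nat.mul_div_cancel_left _ (by norm_num), Nat.mul_div_cancel_left _ (by norm_num)]
  split_ifs with h
  · -- `m` even: `3^m ≡ 1 (mod 4)`
    refine key 1 h3m ?_
    have : 3 ^ m % 4 = 1 := by
      obtain ⟨j, rfl⟩ : ∃ j, m = 2 * j := ⟨m / 2, by omega⟩
      rw [pow_mul]; norm_num [Nat.pow_mod]
    omega
  · -- `m` odd: `3^m ≡ 3 (mod 4)`
    have hm3 : 3 ≤ 3 ^ m := by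
      obtain ⟨j, rfl⟩ : ∃ j, m = 2 * j + 1 := ⟨m / 2, by omega⟩
      calc 3 = 3 ^ 1 := by norm_num
        _ ≤ 3 ^ (2 * j + 1) := Nat.pow_le_pow_right (by norm_num) (by omega)
    refine key 3 hm3 ?_
    have : 3 ^ m % 4 = 3 := by
      obtain ⟨j, rfl⟩ : ∃ j, m = 2 * j + 1 := ⟨m / 2, by omega⟩
      rw [pow_succ, pow_mul]; norm_num [Nat.pow_mod, Nat.mul_mod]
    omega

/-- **`ν(k, λ)` — the tower valuation FORCED by `λ(θ_k)` when `μ_W(θ_k) = 0`:**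
`½ + (λ − 3^{k−1})/φ(3^k)`.  (`ψ(θ_k) = ψ(ω_{k−1})·ψ(u_k)` with `v₃(ζ₃ − 1) = ½` and, by Weierstrass
preparation with `deg u_k < φ(3^k)`, `v₃(u_k(ζ_{3^k} − 1)) = μ(u_k) + λ(u_k)/φ(3^k)`; `λ(u_k) = λ(θ_k)
− 3^{k−1}`.)  "`μ(θ_k) = 0`" (in `W`'s own period normalisation) is typed below INTRINSICALLY as
`T.nu k = some (nuOfLam k (λ(θ_k)))`, `λ` being normalisation-free. [folklore] -/
def nuOfLam (k lamk : ℕ) : ℚ := 1 / 2 + ((lamk : ℚ) - 3 ^ (k - 1)) / (Nat.totient (3 ^ k) : ℚ)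

/-- Census sanity (1890n1, IV*-irr, `(μ,λ)(θ_k) = (0, q_k)`, `ν_k = 1, 10/9, 10/9, 91/81` at
`k = 2..5`; 1080g1, II-irr, `λ(θ_k) = 4, 12, 34`, `ν_k = 2/3, 2/3, 17/27`). [folklore] -/
theorem nuOfLam_examples :
    nuOfLam 2 6 = 1 ∧ nuOfLam 3 20 = 10 / 9 ∧ nuOfLam 4 60 = 10 / 9 ∧ nuOfLam 5 182 = 91 / 81 ∧
      nuOfLam 2 4 = 2 / 3 ∧ nuOfLam 3 12 = 2 / 3 ∧ nuOfLam 4 34 = 17 / 27 := by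
  simp only [nuOfLam, Nat.totient_prime_pow Nat.prime_three (by norm_num : 0 < 2),
    Nat.totient_prime_pow Nat.prime_three (by norm_num : 0 < 3),
    Nat.totient_prime_pow Nat.prime_three (by norm_num : 0 < 4),
    Nat.totient_prime_pow Nat.prime_three (by norm_num : 0 < 5)]
  norm_num

/-- **LEMMA A at `μ = 0` (o6-r1 (G3-12) (b)), the closed form**: `ν(k, λ) = λ/φ(3^k)` for `k ≥ 1` —
the `½ = 3^{k−1}/φ(3^k)` contributed by `ψ(ω_{k−1}) = ζ₃ − 1` and the `(λ(θ_k) − 3^{k−1})/φ(3^k)` of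
the cofactor `u_k` add up to `λ(θ_k)/φ(3^k)`: the tower valuation IS `μ(θ_k) + λ(θ_k)/φ(3^k)` with NO
hypothesis `λ(θ_k) < φ(3^k)` (which fails as a rule on these rows: `q_k > φ(3^k)` for `k ≥ 3`, levels
`L ≥ 1`), because `deg u_k < φ(3^k)`. The kernel statement behind it (the tree's valuation theorem
`Iwasawa.norm_tsum_pow_totient_eq_of_lam_lt_totient` applied to the cofactor, `|ζ₃ − 1|² = 1/3`) is the
prover target `ordChi_mazurTate_eq_of_omegaDvd` of O6-GEN3 §1; this lemma is its arithmetic shadow.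
[folklore] -/
theorem nuOfLam_eq_div (k lamk : ℕ) (hk : 1 ≤ k) :
    nuOfLam k lamk = (lamk : ℚ) / (Nat.totient (3 ^ k) : ℚ) := by
  have hφ : (Nat.totient (3 ^ k) : ℚ) = 2 * 3 ^ (k - 1) := by
    rw [Nat.totient_prime_pow Nat.prime_three (by omega)]; push_cast; ring
  rw [nuOfLam, hφ]
  have h3 : (3 : ℚ) ^ (k - 1) ≠ 0 := pow_ne_zero _ (by norm_num)
  field_simp
  ring

/-- **The sign `lamM(W) := −w(W)·W₃(W)`** (global root number × the local root number at `3` read off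
the Halberstadt–Rizzo table, `rootNumberThree`; the junk-free `W₃` at an additive `3`) = cc-eng-3's
Atkin–Lehner eigenvalue of `f_W` at `M = N/27` on the O6-FW rows (`27 ∥ N`): the bit that S1 finds to
be the PARITY of the signed residual `λ′`. [cite: Rizzo2003, Table II] -/
def lamM (W : WeierstrassCurve ℚ) : ℤ := -(W.rootNumber * W.rootNumberThree)

/-! ## §2 D-R — the O6-dicyclic REDUCIBLE level law (hold-out PASSED; EVIDENCE conjecture over the
tower interfaces) -/

section Laws

/- INTERFACES (definition requests D-O6-ν / D-O6-prof of `O6/TowerInterfaces.lean`): `real W T` = "`T`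
is the tower valuation datum of `W` (from the modular symbol of `W`, period `Ω⁺_W`)", `realLevel W D` =
"`D` is the `3`-power isogeny-class period profile of `W`". Every law is a shell over them; for a fixed
characterisation each is ONE `Prop`; nothing about the data's existence is smuggled in. -/
variable (real : ∀ (W : WeierstrassCurve ℚ) [W.IsElliptic] [W.IsGloballyMinimal],
  O6.TowerValuation W → Prop)
variable (realLevel : ∀ (W : WeierstrassCurve ℚ) [W.IsElliptic] [W.IsGloballyMinimal],
  O6.IsogenyLevelDatum W → Prop)

/-- **D-R, the DICYCLIC LEVEL LAW (CONJECTURE; EVIDENCE-labelled; E1 with pre-registration and a PASSED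
hold-out).** For `W/ℚ` additive at `3` with `f₃ ∈ {3, 5}` (wild dicyclic inertia `C₃ ⋊ C₄`, `v₃Δ_min`
odd — `SubWDicyclic`) and `W[3]|G_{ℚ₃}` REDUCIBLE (`¬ LocIrr W 3`), whose `3`-power isogeny class is fully
tabled with effective level `L = L_dr(W)` (`dicyclicEffectiveLevel`, MAX rule): the tower valuations are
eventually `ν_k(W) = L + ε/φ(3^k)` with ONE integer `ε = ε(W)` (UNSIGNED: no `q`-term, no 2-periodicity).
EVIDENCE: D1 fit (108 dicyclic curves `N ≤ 2 000`, 99 reducible, kit j124364; `d1_fit_score.txt`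
f1fe1832df72ed97): 91/91 fully-tabled rows HIT incl. the isogeny-promoted 54a1 (`L = 3/2`), 8 `f₃ = 5`
rows consistent, onset `k₀ = 1: 66, 2: 21, 3: 4`, `ε ∈ {−2,…,4}`, NO parity law for `ε` (mixed inside
cells — `6L − v₃Δ/2` is a half-integer for odd `v₃Δ`); **HOLD-OUT D1H** (188 curves `2 000 < N ≤ 5 000`,
940 layers `k ≤ 5`, kit j124547 + j124549, frozen scorer `score_d1.py` 31e96a275ba63638, PRE-REG 5
requests.jsonl l.1516; `d1h_score.txt` 8313c50ab7d3a34b): KILLABLE clause "layers (4,5) fit one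
`(L′, ε ∈ ℤ)` and the class is fully tabled ⇒ `L′ = L_dr`" — **151 / 151 HIT, 0 kills**, 28 `f₃ = 5`
confirm-only rows consistent, `k₀ ≤ 3` throughout; dichotomy reducible-on-form 179/179 | LocIrr
off-form 9/9. Typed with `∃ k₀` (no bound asserted; `k₀ ≤ 3` is the measured onset); a deep vanishing
layer (`ν_k = none`, a rank jump in the tower) beyond the census would violate this literal form — the
scorer's killable content is the level identity. Printed antecedent of the SHAPE: Lei–Pollack–Pratap
Thm 2 (pot. good ordinary `p ≥ 5`, under BSD(k_n): `λ(θ_n) = (p−1)v_p(Δ)/12·p^{n−1} + λ(Sel^∨)`, their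
"lack of a global minimal model over k_n" = the Néron-rescaling level) and, for the SELECTOR, Pollack–Weston
Thm 1's reducible branch at `p ∤ N` (`λ(θ_n(f)) = pⁿ − pⁿ⁻¹ + λ(g)`: unsigned, level `L = 1`); nothing is
in print at a wild `3`. Literature set (G3-12): unsigned ⟺ `¬LocIrr` on 139/139 classes `9 ∣ N ≤ 700`,
the D1 levels reappearing at `N = 243` (243a1 `(5,5)`: `L = 7/6`; 243b1 `(5,7)`: `L = 5/6`; all 17 CM
`j = 0` classes unsigned, e.g. 27a1 `λ_k = 3^k − 2`, `L = 3/2`).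
[cite: LeiPollackPratap2024, Thm 2 = Thm 4.7 (p. 13) and Remark after it] [cite: DoyonLei2021, §6]
[cite: PollackWeston2011MT, Thm. 1 (2), reducible case] -/
@[conjecture] def DicyclicLevelLawThree : Prop :=
  ∀ (W : WeierstrassCurve ℚ) [W.IsElliptic] [W.IsGloballyMinimal]
    (T : O6.TowerValuation W) (D : O6.IsogenyLevelDatum W) (L : ℚ),
    Addv W 3 → (condExp W 3 = 3 ∨ condExp W 3 = 5) → ¬ LocIrr W 3 → real W T → realLevel W D →
    dicyclicEffectiveLevel (condExp W 3) (padicValInt 3 W.minimalDiscriminantInt) D.profile = some L →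
    ∃ (ε : ℤ) (k₀ : ℕ), ∀ k : ℕ, k₀ ≤ k →
      T.nu k = some (L + (ε : ℚ) / (Nat.totient (3 ^ k) : ℚ))

/-! ## §3 S1–S4 — the SIGNED POLLACK SHAPE on the LocIrr rows at `f₃ = 3` (PRE-REGISTRATION 5a) -/

/-- **S1 PARITY = SIGN (CONJECTURE; KILLABLE; EVIDENCE-labelled).** For `W` additive at `3` with
`f₃ = 3` and `W[3]|G_{ℚ₃}` IRREDUCIBLE (so `v₃Δ_min ∈ {3 (II, row (2,4,3)), 9 (IV*, row (4,7,9))}`): at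
every layer `k ≥ 2` with `μ_W(θ_k) = 0` (typed: `ν_k = nuOfLam k λ(θ_k)`), the signed residual
`λ′_k := λ(θ_k) − b_k(v₃Δ)` has the parity of the SIGN: `λ′_k` odd ⟺ `lamM(W) = +1` when `v₃Δ = 9`,
⟺ `lamM(W) = −1` when `v₃Δ = 3` (hence constant parity across layers — the frozen first clause).
EVIDENCE (exploratory, cc-eng-3 ENG-D `k = 2, 3`, `engd_theta_out.tsv` f40136cebf7f7bdb): on all 1 909
O6-FW rows with `μ₂ = μ₃ = 0` (IV* 1 297 + II 612) the parity is constant and equals the sign — IV*: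
even ⟺ `lamM = −1` 594/594, odd ⟺ `lamM = +1` 703/703; II: odd ⟺ `lamM = −1` 297/297, even ⟺ `+1`
315/315; 0 exceptions; D1H hold-out `k ≤ 5`: constant parity 9/9; with the sign MEASURED
(`lamM = −w·W₃`, kit j125312/j125307; O6-GEN3 §7): 18/18 dicyclic `LocIrr` rows `k ≤ 5` + 6/6 wild
rows at `N = 459` `k ≤ 6`, 0 exceptions. PRE-REGISTERED KILL (5a, requests.jsonl l.1534): one (row, k)
violating it on the ENG-D level-`3⁵/3⁶` extension (A-ENG3-2, `θ₄, θ₅` on 2 724 rows; cc-eng-3 GEN 3's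
engine 2 already reaches `3⁵, 3⁶, 3⁷` on all 2 724 rows, `eng-3/out/engD2/prod/`). PW's irreducible
branch carries the sign `−ε_n` of the `±`-invariant in the same place. [cite: Pollack2003, Prop. 6.9–6.10]
[cite: PollackWeston2011MT, Thm. 1 (2), irreducible case] -/
@[conjecture] def SignedParityLawThree : Prop :=
  ∀ (W : WeierstrassCurve ℚ) [W.IsElliptic] [W.IsGloballyMinimal] [NeZero (W.conductorNorm ℤ)]
    (f : CuspForm (Gamma0 (W.conductorNorm ℤ)) 2) (T : O6.TowerValuation W),
    IsNewformOf W f → Addv W 3 → condExp W 3 = 3 → LocIrr W 3 → real W T →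
    ∀ (k m : ℕ) (Θ : IwasawaAlgebra 3), 2 ≤ k → O5.IsScaledMazurTateLift f k m Θ → Θ ≠ 0 →
      T.nu k = some (nuOfLam k (lam Θ)) →
      (Odd ((lam Θ : ℤ) - signedBase (padicValInt 3 W.minimalDiscriminantInt) k) ↔
        lamM W = if padicValInt 3 W.minimalDiscriminantInt = 9 then 1 else -1)

/-- **S2 UNIT CRITERION, Kurihara shape (CONJECTURE; KILLABLE; EVIDENCE-labelled).** For `W` additive
at `3`, `f₃ = 3`, `W[3]|G_{ℚ₃}` irreducible, `v₃Δ_min = 9` (IV*-irr), analytic rank `0` and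
`3 ∤ #W(ℚ)_tors · ∏_ℓ c_ℓ · #Ш` (census: `#Ш_an`; `W.shaOrder` here, the same number on these rank-0
rows under BSD₃ — EVIDENCE item, nothing booked): at EVERY layer `k ≥ 2`, `μ_W(θ_k) = 0` and
`λ(θ_k) = b_k = q_k` (`λ′ ≡ 0`: `λ^± = μ^± = 0`, verbatim Kurihara's/Pollack's unit case for good
supersingular `a_p = 0`). EVIDENCE: ENG-D IV* unit rows `(λ′₂, λ′₃) = (0,0)` on 54/54; 1890n1 `k ≤ 7`
(D2, kit j124467); D1H survivor 3510q1 `k ≤ 5`; the killed D-I* "λ′ ≡ 0 on EVERY LocIrr IV* row" was its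
over-extension to non-unit rows (4158o1 `∏c = 6`, 4158q1 `∏c = 3` → `λ′ = 2`; 3132c1). PRE-REGISTERED
KILL (5a): one unit row, one layer `2 ≤ k ≤ 5` (A-ENG3-2). The conjecture is stated for all `k ≥ 2`.
[cite: Kurihara2002, Thm. 0.1] [cite: Pollack2003, Prop. 6.9–6.10] -/
@[conjecture] def SignedUnitCriterionThree : Prop :=
  ∀ (W : WeierstrassCurve ℚ) [W.IsElliptic] [W.IsGloballyMinimal] [NeZero (W.conductorNorm ℤ)]
    (f : CuspForm (Gamma0 (W.conductorNorm ℤ)) 2) (T : O6.TowerValuation W),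
    IsNewformOf W f → Addv W 3 → condExp W 3 = 3 → LocIrr W 3 → real W T →
    W.analyticRank = 0 → padicValInt 3 W.minimalDiscriminantInt = 9 →
    ¬ 3 ∣ W.torsionOrder * W.tamagawaProduct * W.shaOrder →
    ∀ (k m : ℕ) (Θ : IwasawaAlgebra 3), 2 ≤ k → O5.IsScaledMazurTateLift f k m Θ → Θ ≠ 0 →
      lam Θ = signedBase 9 k ∧ T.nu k = some (nuOfLam k (signedBase 9 k))

/-- **S3 STABILISATION (CONJECTURE; MEASURED; EVIDENCE-labelled).** On the same rows the signed
residual is eventually `2`-PERIODIC: `λ(θ_{k+2}) − b_{k+2} = λ(θ_k) − b_k` for `k ≥ k₁(W)` — i.e.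
`λ(θ_k) = b_k + λ′^{(k mod 2)}(W)`, exactly T9's CM-near template `b·3^{n−1} + q_{n−1} + c_{n mod 2}`
(o5-r1) transplanted to the wild rows (o6-r1 (G3-10) TEMPLATE IDENTITY: IV*-irr = III*-near, II-irr =
III-near). EVIDENCE: D1H hold-out `λ′₅ = λ′₃` on 9/9 LocIrr rows (`2→2 ×3, 2→2, 0→0 ×4, 5→5`),
D2 `k ≤ 7` on the 7 IV*-irr D1 rows, 1080g1/1242i1 `k ≤ 7` (`(c₀,c₁) = (1,1), (1,3)`); `k₁ = 2`
FAILS 3/8 (`λ′₄ ≠ λ′₂` on three II rows) — "`n ≫ 0` starts at `k ≥ 3` at the earliest", so the law is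
typed with `∃ k₁` (measured `k₁ = 3`); killable once `k₁` is fixed by A-ENG3-2. λ-only (no interface).
[cite: Pollack2003, Prop. 6.9–6.10] [cite: LeiPollackPratap2024, §4.3 and Conj. 4.11] -/
@[conjecture] def SignedStabilisationLawThree : Prop :=
  ∀ (W : WeierstrassCurve ℚ) [W.IsElliptic] [W.IsGloballyMinimal] [NeZero (W.conductorNorm ℤ)]
    (f : CuspForm (Gamma0 (W.conductorNorm ℤ)) 2),
    IsNewformOf W f → Addv W 3 → condExp W 3 = 3 → LocIrr W 3 →
    ∃ k₁ : ℕ, ∀ (k m m' : ℕ) (Θ Θ' : IwasawaAlgebra 3), k₁ ≤ k →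
      O5.IsScaledMazurTateLift f k m Θ → O5.IsScaledMazurTateLift f (k + 2) m' Θ' → Θ ≠ 0 → Θ' ≠ 0 →
      (lam Θ' : ℤ) - signedBase (padicValInt 3 W.minimalDiscriminantInt) (k + 2) =
        (lam Θ : ℤ) - signedBase (padicValInt 3 W.minimalDiscriminantInt) k

/-- **S4 `μ = 0` FROM LAYER 4 ON (CONJECTURE; MEASURED; EVIDENCE-labelled), typed intrinsically:**
for `k ≥ 4` (and `θ_k ≠ 0`) the tower valuation is the one forced by `λ(θ_k)` alone, `ν_k = ½ +
(λ(θ_k) − 3^{k−1})/φ(3^k)`, i.e. `μ_W(θ_k) = 0` in `W`'s period normalisation. EVIDENCE: D1H `μ(θ_k) =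
0` for all `k ≥ 3` on 9/9 LocIrr rows (`μ₂ = 1` only on 3132c1); ENG-D: `μ₂ = 1` on 593 and `μ₃ = 1` on
73 of 1 987 IV* rows (small-`k` transients) — hence `k ≥ 4` (PRE-REG 5a: MEASURED at `k = 4, 5` by
A-ENG3-2); literature set (G3-12): `μ_k = 0` for `k ≥ 3` on 45/45 `LocIrr` classes to `k = 6` (a
`μ_k ≠ 0` at `k ≥ 3` occurs only on `¬LocIrr` classes with a rational `3`-torsion point, as `μ_k = −1`
in the `Ω⁺`-normalisation without the torsion factor; no class has `μ_k > 0` at `k ≥ 3`).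
[cite: Pollack2003, Prop. 6.9–6.10] [cite: PollackWeston2011MT, Thm. 1 (1)] -/
@[conjecture] def SignedMuZeroLawThree : Prop :=
  ∀ (W : WeierstrassCurve ℚ) [W.IsElliptic] [W.IsGloballyMinimal] [NeZero (W.conductorNorm ℤ)]
    (f : CuspForm (Gamma0 (W.conductorNorm ℤ)) 2) (T : O6.TowerValuation W),
    IsNewformOf W f → Addv W 3 → condExp W 3 = 3 → LocIrr W 3 → real W T →
    ∀ (k m : ℕ) (Θ : IwasawaAlgebra 3), 4 ≤ k → O5.IsScaledMazurTateLift f k m Θ → Θ ≠ 0 →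
      T.nu k = some (nuOfLam k (lam Θ))

/-- **The SIGNED POLLACK SHAPE S1 ∧ S2 ∧ S3 ∧ S4** (A-O6-T3 (b); PRE-REGISTRATION 5a; the irreducible
branch of T-O6-D): on `Addv W 3 ∧ f₃ = 3 ∧ LocIrr W 3`, `μ(θ_k) = 0` (k ≥ 4), `λ(θ_k) = b_k +
λ′^{(k mod 2)}(W)`, parity of `λ′` = the sign `lamM`, `λ′ = 0` on rank-0 unit rows. Support: 2 724
O6-FW rows × `k = 2,3` (two engines agree 8/8 where they overlap) + 18 LocIrr rows `k ≤ 5..7`;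
`k = 4, 5` at scale asked (A-ENG3-2). Conjunction of the four conjecture nodes; nothing new. [folklore] -/
@[conjecture] def SignedPollackShapeThree : Prop :=
  SignedParityLawThree real ∧ SignedUnitCriterionThree real ∧ SignedStabilisationLawThree ∧
    SignedMuZeroLawThree real

/-- Projection: the shape contains the λ-only stabilisation law (no interface). [folklore] -/
theorem SignedPollackShapeThree.stabilisation (h : SignedPollackShapeThree real) :
    SignedStabilisationLawThree := h.2.2.1

end Laws

end Summit.BirchSwinnertonDyer.Rank1Residual.Additive

end
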